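import Summits.QuantumFields.BalabanUV.T4Continuum.Support.NE3BlockPoincareCore
import HarnessLib

/-!
# T⁴ programme, node NE3 — THE LOCAL (STABLE) BLOCK-POINCARÉ INEQUALITY: for EVERY 1-cochain `Y` and every block,
# `Σ_{B} |Y_κ|² ≤ M²·(oscillation of Y_κ over B) + 4M·(κ-segment gradients out of B) + 4·M^{−(d+2)}·|T(z,κ)|²`,
# `T` = the straight block-line sum; summed over the torus: `Σ|Y|² ≤ 5·M²·Σ|∂Y|² + 4·M^{d−2}·Σ_z |(Qcoarse L)^[k] Y z κ|²`

NE3 formalisation swarm `b2b-balaban-t4-ne3-formalise-*`, LEAF PROVER 04 (gen 4): the STABLE∕LOCAL form of this unit's row E-MLw-w3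
core `NE3BlockPoincareCore.sum_norm_sq_le_of_lineMean_bound` (p219635), with the straight block-line average kept EXPLICIT on the
right-hand side instead of being bounded through a torus hypothesis `Σ|S|² ≤ Λ·Σ|div S|²` — the shape asked for by leaf-03-g6 (SHAPE
E-MLw-w3 §2(ii)) and named by leaf-02-g4 (N-ne3leaf02g4-1 l.14487 (3): «the right shape for that split»), offered in this unit's ROW COMPLETE
line (CLAIMS.log l.14198).  It is block-LOCAL (no torus step, no tangency, no Landau, no `N`), hence the flat template of any LOCAL
architecture for the (w4) core (leaf-03-g6's numerics NUM-ne3leaf03g6-1: tangent ∩ Landau fields live at scale ≤ 2σ).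

CONTENT (all [folklore]; 0 sorry; 0 def; complex-valued cochains as in the core — the matrix∕`nhsNormSq` currency follows entrywise
exactly as in `NE3BlockPoincareTangent`):
* **`sum_block_norm_sq_le`** — ONE BLOCK, ONE COMPONENT, EVERY `Y`: for `M ≥ 1`, `q = M•z`,
  `M²·M^d·Σ_{v∈B_M} |Y(q+v,κ)|² ≤ M²·M^d·M²·Σ_{v∈B_M}Σ_μ |Y(q+v+e_μ,κ) − Y(q+v,κ)|² + 4·M²·M^{d+1}·Σ_{v∈B_M}Σ_{j<M} |Y(q+v+(j+1)e_κ,κ) − Y(q+v+je_κ,κ)|²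
   + 4·|Σ_{v∈B_M}Σ_{i<M} Y(q+v+ie_κ,κ)|²` (block-mean oscillation `NE3CoarseTorusExact.sum_norm_sub_blockMean_sq_le` (M²∕2) + line-vs-block
  mean `NE3BlockLineAverage.norm_lineMean_sub_blockMean_sq_le`; the proof of the core's step (1), now a theorem);
* **`sum_norm_sq_le_stable`** — summed over the torus `periodBox (L^k·N)` for an `(L^k·N)`-periodic `Y` (periodicity is used ONLY to
  re-tile the shifted gradient sums):
  `Σ_x Σ_κ |Y x κ|² ≤ 5·(L^k)²·Σ_x Σ_κ Σ_μ |Y(x+e_μ) κ − Y x κ|² + 4·((L^k)^d ∕ (L^k)²)·Σ_{z∈periodBox N} Σ_κ |(Qcoarse L)^[k] Y z κ|²`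
  (`NE3BlockLineAverage.iterate_Qcoarse_apply`: `(Qcoarse L)^[k] Y = M^{−d}·T`).
The core p219635 is `sum_norm_sq_le_stable` + its step (3) (`Σ|T|² ≤ Λ·Σ|div T|²`, `div T` telescoped to gradients); the two instances
(Λ = N²∕2 on the k-fold tangent space, Λ = 0 on `ker (Qcoarse L)^[k]`) are unchanged.

HONEST: flat-lattice kinematics on OUR frame; no statement about Bałaban's minimisers, (P_W), (ML_w), T-E_w or NE3; NE3 NOT proved; spine
0∕9; finite T⁴ rung (B)+1 — NOT infinite volume, NOT mass gap, NOT BetaPertH, NOT Clay.  Context only: [Balaban1985PropagatorsII] §3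
(localised lower bounds).  PLACEMENT: `Summits/QuantumFields/BalabanUV/`.
-/

set_option autoImplicit false

open scoped BigOperators
open Finset

namespace Summit.QuantumFields.BalabanUV.T4Continuum.NE3BlockPoincareLocal

open Literature.MathematicalPhysics.QuantumFieldTheory.Balaban1983to89
open B7Prop1Explicit
open T4AveragingDeficitWallBoundary (periodBox mem_periodBox card_periodBox sum_periodBox_shift)
open NE3TangentFlatStructure (Qcoarse)
open NE3BlockLineAverage (iterate_Qcoarse_apply norm_lineMean_sub_blockMean_sq_le)
open NE3CoarseTorusExact (sum_norm_sub_blockMean_sq_le)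
open NE3BlockPoincareCore (norm_sq_le_two_mul sum_norm_sq_le_of_mean sum_rotate3 sum_blocks_torus sum_blocks_torus_shift)

noncomputable section

variable {d : ℕ}

/-! ## §1 One block, one component, every cochain -/

/-- **THE LOCAL BLOCK-POINCARÉ INEQUALITY** (one block `B_M(M•z)`, one component `κ`, EVERY complex 1-cochain `Y`, `M ≥ 1`):
`M²·M^d·Σ_{v∈B}|Y(M•z+v,κ)|² ≤ M²·M^d·(M²·Σ_{v∈B}Σ_μ|Y(M•z+v+e_μ,κ) − Y(M•z+v,κ)|²) + 4·(M²·(M^d·M)·Σ_{v∈B}Σ_{j<M}|Y(M•z+v+(j+1)e_κ,κ) − Y(M•z+v+je_κ,κ)|²)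
 + 4·|Σ_{v∈B}Σ_{i<M} Y(M•z+v+ie_κ,κ)|²` — oscillation about the block mean, block mean against the block-line sum, and the block-line sum
itself, kept explicit. [folklore] -/
theorem sum_block_norm_sq_le {M : ℕ} (hM : 1 ≤ M) (Y : Site d → Fin d → ℂ) (z : Site d) (κ : Fin d) :
    (M : ℝ) ^ 2 * (M : ℝ) ^ d * ∑ v ∈ periodBox (d := d) M, ‖Y ((M : ℤ) • z + v) κ‖ ^ 2
      ≤ (M : ℝ) ^ 2 * (M : ℝ) ^ d
            * ((M : ℝ) ^ 2 * ∑ v ∈ periodBox (d := d) M, ∑ μ : Fin d, ‖Y ((M : ℤ) • z + v + e μ) κ - Y ((M : ℤ) • z + v) κ‖ ^ 2)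
        + 4 * ((M : ℝ) ^ 2 * ((M : ℝ) ^ d * M)
            * ∑ v ∈ periodBox (d := d) M, ∑ j ∈ range M,
                ‖Y ((M : ℤ) • z + v + ((j : ℤ) + 1) • e κ) κ - Y ((M : ℤ) • z + v + (j : ℤ) • e κ) κ‖ ^ 2)
        + 4 * ‖∑ v ∈ periodBox (d := d) M, ∑ i ∈ range M, Y ((M : ℤ) • z + v + (i : ℤ) • e κ) κ‖ ^ 2 := by
  have hM0 : (0 : ℝ) < M := by exact_mod_cast (by omega : 0 < M)
  set B : Finset (Site d) := periodBox (d := d) M with hBdef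
  have hcardB : (B.card : ℝ) = (M : ℝ) ^ d := by rw [hBdef, card_periodBox]; push_cast; ring
  set q : Site d := (M : ℤ) • z with hq
  set A : ℂ := ∑ v ∈ B, Y (q + v) κ with hA
  set T : ℂ := ∑ v ∈ B, ∑ i ∈ range M, Y (q + v + (i : ℤ) • e κ) κ with hT
  -- oscillation about the block mean and the abstract mean split
  have hosc := sum_norm_sub_blockMean_sq_le hM (fun x => Y x κ) q
  have hmean := sum_norm_sq_le_of_mean B (fun v => Y (q + v) κ) (A / ((M : ℂ) ^ d))
  have hnormm : (B.card : ℝ) * ‖A / ((M : ℂ) ^ d)‖ ^ 2 = ‖A‖ ^ 2 / (M : ℝ) ^ d := by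
    rw [norm_div, norm_pow, Complex.norm_natCast, hcardB, div_pow]
    field_simp
  -- the block mean against the block-line sum
  have hline := norm_lineMean_sub_blockMean_sq_le Y q κ B M
  have hA2 : (M : ℝ) ^ 2 * ‖A‖ ^ 2 ≤ 2 * ‖T - (M : ℝ) • A‖ ^ 2 + 2 * ‖T‖ ^ 2 := by
    have h := norm_sq_le_two_mul ((M : ℝ) • A) T
    rw [norm_smul, Real.norm_eq_abs, abs_of_pos hM0, mul_pow, norm_sub_rev] at h
    exact h
  have hTA : ‖T - (M : ℝ) • A‖ ^ 2
      ≤ (M : ℝ) ^ 2 * (B.card * M)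
          * ∑ v ∈ B, ∑ j ∈ range M, ‖Y (q + v + ((j : ℤ) + 1) • e κ) κ - Y (q + v + (j : ℤ) • e κ) κ‖ ^ 2 := by
    simpa only [hT, hA] using hline
  rw [hcardB] at hTA
  -- assemble
  have hMd0 : (0 : ℝ) < (M : ℝ) ^ d := by positivity
  have step1 : (M : ℝ) ^ 2 * (M : ℝ) ^ d * ∑ v ∈ B, ‖Y (q + v) κ‖ ^ 2
      ≤ (M : ℝ) ^ 2 * (M : ℝ) ^ d * (2 * ∑ v ∈ B, ‖Y (q + v) κ - A / ((M : ℂ) ^ d)‖ ^ 2) + 2 * ((M : ℝ) ^ 2 * ‖A‖ ^ 2) := by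
    have := mul_le_mul_of_nonneg_left hmean (le_of_lt (mul_pos (pow_pos hM0 2) hMd0))
    refine this.trans (le_of_eq ?_)
    rw [mul_add, mul_assoc (2 : ℝ) (B.card : ℝ), hnormm]
    field_simp
  have step2 : (M : ℝ) ^ 2 * (M : ℝ) ^ d * (2 * ∑ v ∈ B, ‖Y (q + v) κ - A / ((M : ℂ) ^ d)‖ ^ 2)
      ≤ (M : ℝ) ^ 2 * (M : ℝ) ^ d * ((M : ℝ) ^ 2 * ∑ v ∈ B, ∑ μ : Fin d, ‖Y (q + v + e μ) κ - Y (q + v) κ‖ ^ 2) := by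
    refine mul_le_mul_of_nonneg_left ?_ (le_of_lt (mul_pos (pow_pos hM0 2) hMd0))
    have hosc' : ∑ v ∈ B, ‖Y (q + v) κ - A / ((M : ℂ) ^ d)‖ ^ 2
        ≤ (M : ℝ) ^ 2 / 2 * ∑ v ∈ B, ∑ μ : Fin d, ‖Y (q + v + e μ) κ - Y (q + v) κ‖ ^ 2 := by
      simpa only [hA] using hosc
    linarith [hosc']
  nlinarith [step1, step2, hA2, hTA, norm_nonneg T]

/-! ## §2 Summed over the torus: the stable form of the core -/

/-- **THE STABLE BLOCK-POINCARÉ INEQUALITY ON THE TORUS**: for `L ≥ 1`, `N ≥ 1`, `M = L^k` and an `(M·N)`-periodic complex 1-cochain `Y`,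
`Σ_x Σ_κ |Y x κ|² ≤ 5·M²·Σ_x Σ_κ Σ_μ |Y(x+e_μ) κ − Y x κ|² + 4·(M^d ∕ M²)·Σ_{z∈periodBox N} Σ_κ |(Qcoarse L)^[k] Y z κ|²` over `periodBox (M·N)` —
EVERY periodic `Y`, no tangency, no Landau; the straight k-block average stays on the right.  (The core p219635 =
this + `Σ|S|² ≤ Λ·Σ|div S|²`.) [folklore] -/
theorem sum_norm_sq_le_stable {L : ℕ} (hL : 1 ≤ L) {N : ℕ} (hN : 1 ≤ N) (k : ℕ) (Y : Site d → Fin d → ℂ)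
    (hY : ∀ (x : Site d) (τ μ : Fin d), Y (x + ((L ^ k * N : ℕ) : ℤ) • e τ) μ = Y x μ) :
    ∑ x ∈ periodBox (d := d) (L ^ k * N), ∑ κ : Fin d, ‖Y x κ‖ ^ 2
      ≤ 5 * ((L : ℝ) ^ k) ^ 2
            * ∑ x ∈ periodBox (d := d) (L ^ k * N), ∑ κ : Fin d, ∑ μ : Fin d, ‖Y (x + e μ) κ - Y x κ‖ ^ 2
        + 4 * (((L : ℝ) ^ k) ^ d / ((L : ℝ) ^ k) ^ 2)
            * ∑ z ∈ periodBox (d := d) N, ∑ κ : Fin d, ‖(Qcoarse L)^[k] Y z κ‖ ^ 2 := by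
  -- notation
  set M : ℕ := L ^ k with hMdef
  have hM : 1 ≤ M := Nat.one_le_pow _ _ hL
  have hM0 : (0 : ℝ) < M := by exact_mod_cast (by omega : 0 < M)
  have hMR : ((L : ℝ) ^ k) = (M : ℝ) := by rw [hMdef]; push_cast; ring
  set B : Finset (Site d) := periodBox (d := d) M with hBdef
  set g : Fin d → Site d → ℝ := fun κ x => ‖Y (x + e κ) κ - Y x κ‖ ^ 2 with hgdef
  set G : ℝ := ∑ x ∈ periodBox (d := d) (M * N), ∑ κ : Fin d, ∑ μ : Fin d, ‖Y (x + e μ) κ - Y x κ‖ ^ 2 with hGdef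
  have hG0 : 0 ≤ G := by positivity
  have hgper : ∀ (κ : Fin d) (x : Site d) (τ : Fin d), g κ (x + ((M * N : ℕ) : ℤ) • e τ) = g κ x := by
    intro κ x τ
    simp only [hgdef]
    rw [add_right_comm, hY, hY]
  have hdiag : ∑ κ : Fin d, ∑ x ∈ periodBox (d := d) (M * N), g κ x ≤ G := by
    rw [hGdef, Finset.sum_comm]
    refine Finset.sum_le_sum fun x _ => Finset.sum_le_sum fun κ _ => ?_
    exact Finset.single_le_sum (f := fun μ => ‖Y (x + e μ) κ - Y x κ‖ ^ 2) (fun _ _ => sq_nonneg _) (Finset.mem_univ κ)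
  -- the line sums and the tiling identity
  set T : Site d → Fin d → ℂ := fun z κ => ∑ v ∈ B, ∑ i ∈ range M, Y ((M : ℤ) • z + v + (i : ℤ) • e κ) κ with hTdef
  have htil : ∀ (z : Site d) (κ : Fin d), (Qcoarse L)^[k] Y z κ = (((M : ℝ) ^ d)⁻¹ : ℝ) • T z κ := by
    intro z κ
    exact iterate_Qcoarse_apply hL k Y z κ
  have hTS : ∀ (z : Site d) (κ : Fin d), ‖T z κ‖ ^ 2 = ((M : ℝ) ^ d) ^ 2 * ‖(Qcoarse L)^[k] Y z κ‖ ^ 2 := by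
    intro z κ
    rw [htil, norm_smul, Real.norm_eq_abs, abs_of_pos (by positivity), mul_pow]
    field_simp
  -- (1) per block: the local inequality
  have hblock := fun (z : Site d) (κ : Fin d) => sum_block_norm_sq_le hM Y z κ
  -- (2) sum over blocks and components
  have hsumY : ∑ z ∈ periodBox (d := d) N, ∑ κ : Fin d, ∑ v ∈ B, ‖Y ((M : ℤ) • z + v) κ‖ ^ 2
      = ∑ x ∈ periodBox (d := d) (M * N), ∑ κ : Fin d, ‖Y x κ‖ ^ 2 := by
    rw [← sum_blocks_torus hM N (fun x => ∑ κ : Fin d, ‖Y x κ‖ ^ 2)]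
    exact Finset.sum_congr rfl fun z _ => Finset.sum_comm
  have hsumOsc : ∑ z ∈ periodBox (d := d) N, ∑ κ : Fin d,
        ∑ v ∈ B, ∑ μ : Fin d, ‖Y ((M : ℤ) • z + v + e μ) κ - Y ((M : ℤ) • z + v) κ‖ ^ 2 = G := by
    rw [hGdef, ← sum_blocks_torus hM N (fun x => ∑ κ : Fin d, ∑ μ : Fin d, ‖Y (x + e μ) κ - Y x κ‖ ^ 2)]
    exact Finset.sum_congr rfl fun z _ => Finset.sum_comm
  have hsumSeg : ∑ z ∈ periodBox (d := d) N, ∑ κ : Fin d,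
        ∑ v ∈ B, ∑ j ∈ range M, ‖Y ((M : ℤ) • z + v + ((j : ℤ) + 1) • e κ) κ - Y ((M : ℤ) • z + v + (j : ℤ) • e κ) κ‖ ^ 2
      ≤ M * G := by
    calc ∑ z ∈ periodBox (d := d) N, ∑ κ : Fin d,
          ∑ v ∈ B, ∑ j ∈ range M, ‖Y ((M : ℤ) • z + v + ((j : ℤ) + 1) • e κ) κ - Y ((M : ℤ) • z + v + (j : ℤ) • e κ) κ‖ ^ 2
        = ∑ κ : Fin d, ∑ z ∈ periodBox (d := d) N, ∑ v ∈ B, ∑ j ∈ range M, g κ ((M : ℤ) • z + v + (j : ℤ) • e κ) := by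
          rw [Finset.sum_comm]
          refine Finset.sum_congr rfl fun κ _ => Finset.sum_congr rfl fun z _ => Finset.sum_congr rfl fun v _ =>
            Finset.sum_congr rfl fun j _ => ?_
          simp only [hgdef, add_one_zsmul, add_assoc]
      _ = ∑ κ : Fin d, ∑ j ∈ range M, ∑ z ∈ periodBox (d := d) N, ∑ v ∈ B, g κ ((M : ℤ) • z + v + (j : ℤ) • e κ) :=
          Finset.sum_congr rfl fun κ _ => sum_rotate3 _ _ _ _
      _ = ∑ κ : Fin d, ∑ _j ∈ range M, ∑ x ∈ periodBox (d := d) (M * N), g κ x := by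
          refine Finset.sum_congr rfl fun κ _ => Finset.sum_congr rfl fun j _ => ?_
          exact sum_blocks_torus_shift hM hN (hgper κ) _
      _ = M * ∑ κ : Fin d, ∑ x ∈ periodBox (d := d) (M * N), g κ x := by
          rw [Finset.mul_sum]
          refine Finset.sum_congr rfl fun κ _ => ?_
          rw [Finset.sum_const, card_range, nsmul_eq_mul]
      _ ≤ M * G := mul_le_mul_of_nonneg_left hdiag (Nat.cast_nonneg M)
  -- (3) conclude
  have hfinal : (M : ℝ) ^ 2 * (M : ℝ) ^ d * ∑ x ∈ periodBox (d := d) (M * N), ∑ κ : Fin d, ‖Y x κ‖ ^ 2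
      ≤ (M : ℝ) ^ 2 * (M : ℝ) ^ d * (5 * (M : ℝ) ^ 2 * G
          + 4 * ((M : ℝ) ^ d / (M : ℝ) ^ 2) * ∑ z ∈ periodBox (d := d) N, ∑ κ : Fin d, ‖(Qcoarse L)^[k] Y z κ‖ ^ 2) := by
    have hsum := Finset.sum_le_sum fun z (_ : z ∈ periodBox (d := d) N) =>
      Finset.sum_le_sum fun κ (_ : κ ∈ (Finset.univ : Finset (Fin d))) => hblock z κ
    rw [← hsumY]
    simp only [Finset.sum_add_distrib, ← Finset.mul_sum] at hsum
    refine hsum.trans ?_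
    rw [hsumOsc]
    have e1 : 4 * ((M : ℝ) ^ 2 * ((M : ℝ) ^ d * M) * ∑ z ∈ periodBox (d := d) N, ∑ κ : Fin d,
          ∑ v ∈ B, ∑ j ∈ range M, ‖Y ((M : ℤ) • z + v + ((j : ℤ) + 1) • e κ) κ - Y ((M : ℤ) • z + v + (j : ℤ) • e κ) κ‖ ^ 2)
        ≤ 4 * ((M : ℝ) ^ 2 * ((M : ℝ) ^ d * M) * (M * G)) :=
      mul_le_mul_of_nonneg_left (mul_le_mul_of_nonneg_left hsumSeg (by positivity)) (by norm_num)
    have e2 : 4 * ∑ z ∈ periodBox (d := d) N, ∑ κ : Fin d, ‖T z κ‖ ^ 2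
        = (M : ℝ) ^ 2 * (M : ℝ) ^ d * (4 * ((M : ℝ) ^ d / (M : ℝ) ^ 2)
            * ∑ z ∈ periodBox (d := d) N, ∑ κ : Fin d, ‖(Qcoarse L)^[k] Y z κ‖ ^ 2) := by
      simp_rw [hTS, ← Finset.mul_sum]
      field_simp
    have e3 : (M : ℝ) ^ 2 * (M : ℝ) ^ d * ((M : ℝ) ^ 2 * G) + 4 * ((M : ℝ) ^ 2 * ((M : ℝ) ^ d * M) * (M * G))
        = (M : ℝ) ^ 2 * (M : ℝ) ^ d * (5 * (M : ℝ) ^ 2 * G) := by ring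
    nlinarith [e1, e2, e3, hG0]
  have hpos : (0 : ℝ) < (M : ℝ) ^ 2 * (M : ℝ) ^ d := by positivity
  rw [hMR, show (L ^ k * N : ℕ) = M * N from rfl]
  exact le_of_mul_le_mul_left hfinal hpos

end

end Summit.QuantumFields.BalabanUV.T4Continuum.NE3BlockPoincareLocal
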